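import Summits.AtomisticToContinuum.Crystallization.Theses.HullMinimality
import Summits.AtomisticToContinuum.Crystallization.Theorems.NashClassCertificatesNashHullBridge
import Summits.AtomisticToContinuum.Crystallization.Theorems.HullMinimalityLayeredWindowsReductions
import Summits.AtomisticToContinuum.Crystallization.Theorems.HullMinimalityLayeredWindowsFrequently
import Summits.AtomisticToContinuum.Crystallization.Theorems.HullMinimalityLayeredWindowsNecessity

/-!
# Crux `HullMinimality.LayeredWindows` (stmt-AtomisticToContinuum-11778) — ALTERNATIVE line `minimal-core`
# (crux-strategist s1, 2026-08-17; registered next to the live line `registered` v5, which it does NOT replace)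

The live line closes the crux modulo {S1 `stub_twoShellGoodWindowsFreq`, S2 = item 16827 `NashNearField`}.
S1 is PROVED NECESSARY (`LayeredWindowsLocal.layeredWindows_necessity`), so no line can avoid it and this one keeps it
verbatim (same stub name and signature: a proof of S1 serves both lines).  What changes is the SECOND stub.

* S2' `stub_cleanCoreOfGoodBall` — CLEAN CORE OF LARGE GOOD BALLS OF A GROUND STATE (qualitative, minimisers only):
  for every `η > 0` and `R'` there is `ρ` such that in every Lennard-Jones GROUND STATE, if some particle's `ρ`-ball is
  all two-shell good, then some particle has its whole `R'`-ball `Good` and `LayeredNear η`.  This is exactly what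
  the crux consumes from the near-field programme: it is the conclusion of the landed `LayeredWindowsLocal.cleanCentre_of_goodBall`
  with its hypothesis `NashNearField` removed, hence S2' ⇐ item 16827 (`stub_cleanCoreOfGoodBall_of_nashNearField` below,
  landed proof) ⇐ item 13958.  It is WEAKER than 16827 in three ways that matter for attack and for survival:
  (i) only ground states (global minimisers), not the whole 1/3-separated Nash class — so multi-particle SURGERY
  (cut a strained sub-ball, paste a relaxed crystal: bulk gain `c η² r³` against interface `C r²`) and local-limit /
  compactness arguments are available; (ii) qualitative (`∃ ρ(η, R')`), no linear-in-count pricing, no radius-4 boundary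
  constant; (iii) only ALL-GOOD balls (no bad matter inside `Ω`).  A refutation of 16827 by a force-balanced strained
  Nash configuration held by bad matter (its recorded risk) does not touch S2'.
* Composition: S1 gives all-good `ρ`-balls frequently; S2' turns each into a clean centre; clean centres frequently give
  the crux by the landed `windowsOfGluing_freq` + `PrestressSplitKorn.stub_layeredGluing` (equivalently
  `layeredWindows_iff_cleanCentresFreq`).  Kernel-checked below: `LayeredWindows_of` concludes the crux BY NAME.

Hardest stub: S1 (unchanged; the positional core of 3-D LJ crystallization).  S2' is L-sized: intended proofs (a) via 16827/13958
(landed implication), (b) directly for minimisers: surgery upper bound `Σ_{B_ρ}(e_i − e*) ≤ C ρ²` (cf. `stub_localExcess`) +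
Cauchy–Born/phonon coercivity of the relaxed Barlow family on all-good regions + interior regularity of the force-balanced
displacement field (mean-value inequality turns one `η`-strained site into `c η² R'³` of energy in its `R'`-ball).
-/

noncomputable section

open scoped BigOperators Classical InnerProductSpace
open Filter Topology

namespace Summit.AtomisticToContinuum.Crystallization.Cruxes.LayeredWindows.MinimalCore

open Summit.AtomisticToContinuum.Crystallization.Theses
open Summit.AtomisticToContinuum.Crystallization.Theorems
open Summit.AtomisticToContinuum.Crystallization.Theorems.PrestressSplitKorn
open Summit.AtomisticToContinuum.Crystallization.Theorems.LayeredWindowsLocal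
open Summit.AtomisticToContinuum.Crystallization.Theorems.DefectFreeCrystallizes.Negative.PredicateAPI (Good)
open Literature.MathematicalPhysics.StatisticalMechanics Literature.Geometry.DiscreteGeometry

local notation "E3" => EuclideanSpace ℝ (Fin 3)

/-! ## The stubs -/

/-- **Stub S1 `stub_twoShellGoodWindowsFreq`** (shared VERBATIM with line `registered`; crux-sized; PROVED NECESSARY
for the crux by `LayeredWindowsLocal.layeredWindows_necessity`). Along every Lennard-Jones ground-state sequence and
for every radius `ρ`, frequently in `N`, some particle has every particle within `ρ` of it two-shell good. -/
theorem stub_twoShellGoodWindowsFreq :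
    ∀ x : (N : ℕ) → (Fin N → E3), (∀ N, IsGroundState lennardJones (x N)) → ∀ ρ : ℝ, ∃ᶠ N : ℕ in atTop, ∃ i : Fin N, ∀ j : Fin N, dist (x N j) (x N i) ≤ ρ → IsTwoShellGood (1 / 20) (47 / 50) 1 (x N) j := by
  sorry

/-- **Stub S2' `stub_cleanCoreOfGoodBall`** (NEW second stub; L-sized; ground states only, qualitative).
For every `η > 0` and `R'` there is `ρ` such that in every Lennard-Jones ground state `y`: if every particle within
`ρ` of `y i₀` is two-shell good, then some particle has its whole `R'`-ball `Good` and `LayeredNear η`.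
(= the conclusion of `LayeredWindowsLocal.cleanCentre_of_goodBall` without its hypothesis `NashNearField`.) -/
theorem stub_cleanCoreOfGoodBall :
    ∀ η : ℝ, 0 < η → ∀ R' : ℝ, ∃ ρ : ℝ, ∀ (N : ℕ) (y : Fin N → E3), IsGroundState lennardJones y →
      ∀ i₀ : Fin N, (∀ j : Fin N, dist (y j) (y i₀) ≤ ρ → IsTwoShellGood (1 / 20) (47 / 50) 1 y j) →
        ∃ i : Fin N, ∀ j : Fin N, dist (y j) (y i) ≤ R' → Good y j ∧ LayeredNear η y j := by
  sorry

/-! ## Landed facts around the stubs (no sorry below except through S1/S2') -/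

/-- S2' follows from item 16827 (`NashNearField`): this is `cleanCentre_of_goodBall` (LANDED p154375). Hence S2' ⇐ 16827 ⇐ 13958. -/
theorem stub_cleanCoreOfGoodBall_of_nashNearField
    (hNF : Summit.AtomisticToContinuum.Crystallization.Theses.NashClassCertificates.NashNearField) :
    ∀ η : ℝ, 0 < η → ∀ R' : ℝ, ∃ ρ : ℝ, ∀ (N : ℕ) (y : Fin N → E3), IsGroundState lennardJones y →
      ∀ i₀ : Fin N, (∀ j : Fin N, dist (y j) (y i₀) ≤ ρ → IsTwoShellGood (1 / 20) (47 / 50) 1 y j) →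
        ∃ i : Fin N, ∀ j : Fin N, dist (y j) (y i) ≤ R' → Good y j ∧ LayeredNear η y j :=
  cleanCentre_of_goodBall hNF

/-- S1 is NECESSARY for the crux (LANDED `layeredWindows_necessity`). -/
theorem stub_twoShellGoodWindowsFreq_of_crux
    (hLW : Summit.AtomisticToContinuum.Crystallization.Theses.HullMinimality.LayeredWindows) :
    ∀ x : (N : ℕ) → (Fin N → E3), (∀ N, IsGroundState lennardJones (x N)) → ∀ ρ : ℝ,
      ∃ᶠ N : ℕ in atTop, ∃ i : Fin N, ∀ j : Fin N, dist (x N j) (x N i) ≤ ρ → IsTwoShellGood (1 / 20) (47 / 50) 1 (x N) j :=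
  layeredWindows_necessity hLW

/-- **Clean centres frequently from the two stubs** (the `∃ᶠ N` form; pure logic over the stubs). -/
theorem cleanCentresFreq_of_stubs
    (h1 : ∀ x : (N : ℕ) → (Fin N → E3), (∀ N, IsGroundState lennardJones (x N)) → ∀ ρ : ℝ,
      ∃ᶠ N : ℕ in atTop, ∃ i : Fin N, ∀ j : Fin N, dist (x N j) (x N i) ≤ ρ → IsTwoShellGood (1 / 20) (47 / 50) 1 (x N) j)
    (h2 : ∀ η : ℝ, 0 < η → ∀ R' : ℝ, ∃ ρ : ℝ, ∀ (N : ℕ) (y : Fin N → E3), IsGroundState lennardJones y →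
      ∀ i₀ : Fin N, (∀ j : Fin N, dist (y j) (y i₀) ≤ ρ → IsTwoShellGood (1 / 20) (47 / 50) 1 y j) →
        ∃ i : Fin N, ∀ j : Fin N, dist (y j) (y i) ≤ R' → Good y j ∧ LayeredNear η y j)
    (x : (N : ℕ) → (Fin N → E3)) (hx : ∀ N, IsGroundState lennardJones (x N)) :
    ∀ η : ℝ, 0 < η → ∀ R' : ℝ, ∃ᶠ N : ℕ in atTop, ∃ i : Fin N, ∀ j : Fin N,
      dist (x N j) (x N i) ≤ R' → Good (x N) j ∧ LayeredNear η (x N) j := by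
  intro η hη R'
  obtain ⟨ρ, hρ⟩ := h2 η hη R'
  exact (h1 x hx ρ).mono fun N ⟨i₀, hi₀⟩ => hρ N (x N) (hx N) i₀ hi₀

/-- **Unconditionally the crux is EQUIVALENT to "clean centres frequently"** (LANDED): what S1 + S2' deliver is exactly
the right-hand side, so the pair {S1, S2'} is sufficient; S1 is necessary; S2' is the uniform-in-configuration upgrade. -/
theorem crux_iff_cleanCentresFreq :
    Summit.AtomisticToContinuum.Crystallization.Theses.HullMinimality.LayeredWindows ↔
      ∀ x : (N : ℕ) → (Fin N → E3), (∀ N, IsGroundState lennardJones (x N)) →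
        ∀ η : ℝ, 0 < η → ∀ R' : ℝ, ∃ᶠ N : ℕ in atTop, ∃ i : Fin N, ∀ j : Fin N,
          dist (x N j) (x N i) ≤ R' → Good (x N) j ∧ LayeredNear η (x N) j :=
  layeredWindows_iff_cleanCentresFreq

/-! ## Composition -/

/-- **The line concludes the crux by name**: `LayeredWindows` from S1 and S2' through the landed gluing
(`windowsOfGluing_freq` with `PrestressSplitKorn.stub_layeredGluing`). -/
theorem LayeredWindows_of : Summit.AtomisticToContinuum.Crystallization.Theses.HullMinimality.LayeredWindows :=
  fun x hx => windowsOfGluing_freq stub_layeredGluing x hx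
    (cleanCentresFreq_of_stubs stub_twoShellGoodWindowsFreq stub_cleanCoreOfGoodBall x hx)

end Summit.AtomisticToContinuum.Crystallization.Cruxes.LayeredWindows.MinimalCore

end
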